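import Summits.MatrixMultiplication.OmegaCensus.STPPVosperCoverSearchWSound

/-!
# ω-census (abelian STPP census): the EXTRACTION lemma for the cover search WITH WORDS — an STPP family makes `coverSearchW` succeed (kernel, UNCONDITIONAL)

HONEST FRAMING (pub-omega census; verbatim): lottery ticket; floor = certified bounds/negative ranges.
Census STRUCTURE (seat pub-omega-stpp-2 gen 25, 2026-08-28), family (b2).  `coverSearchW_of_isSTPP`: the hypotheses of `coverSearch_of_isSTPP`
(`STPPVosperCoverExtract.lean`) ALSO give `coverSearchW … = true` (`STPPVosperCoverSearchW.lean`): the word facts of `coverYW_complete` follow from the STPP —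
`((c−a) + (a′−b))·u` is the `Y°`-value of `c − a + a′ − b`, which lies in no `C_j − B_j` unless the two `A`-letters coincide (Def. 5.1 word with `s ≠ s′` or with
the `A`-letters in different blocks), and `((c−a) + (b−b′))·u` is the `Z°`-value of `c − a + b − b′`, which lies in no `C_j − A_j` unless `b = b′` (word with
`t ≠ t′`).  So `coverSearchW … = false` (decided by the kernel) excludes the family.  Nothing here is progress on `ω`.

References: H. Cohn, R. Kleinberg, B. Szegedy, C. Umans, FOCS 2005 (arXiv:math/0511460), Def. 5.1.
-/

open Finset
open scoped Pointwise

namespace Summit.MatrixMultiplication.OmegaCensus.CubeNB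

open Literature.Computability.AlgebraicComplexity
open Literature.Combinatorics.Additive
open Summit.MatrixMultiplication.OmegaCensus.STPPKneser

/-! ## §1 Extraction with words -/

section Extract

variable {p : ℕ} [hp : Fact p.Prime] {N : ℕ} {A B C : Fin N → Finset (ZMod p)}

/-- **Extraction with words.**  See the module docstring and `coverSearch_of_isSTPP`. [cite: CohnKleinbergSzegedyUmans2005, Def. 5.1] -/
theorem coverSearchW_of_isSTPP (hS : IsSTPP A B C) (hA : ∀ k, (A k).Nonempty) (hB : ∀ k, (B k).Nonempty) (hC : ∀ k, (C k).Nonempty)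
    (i : Fin N) (ks : List (Fin N)) (hks : ks.Nodup) (hksi : ∀ k, k ∈ ks ↔ k ≠ i) {u y₀ z₀ : ZMod p} (hu0 : u ≠ 0) {YL ZL : List ℕ}
    (hY1 : ∀ x ∈ DU B C (univ.erase i), (u * (x - y₀)).val ∈ YL) (hY2 : ∀ t ∈ YL, ∃ x ∈ DU B C (univ.erase i), (u * (x - y₀)).val = t)
    (hZ1 : ∀ x ∈ DU A C (univ.erase i), (u * (x - z₀)).val ∈ ZL) (hZ2 : ∀ t ∈ ZL, ∃ x ∈ DU A C (univ.erase i), (u * (x - z₀)).val = t) :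
    coverSearchW p YL ZL (ks.map fun k => (#(A k), #(B k), #(C k))) = true := by
  rw [coverSearchW]
  -- the minimising pair of each block
  set f : ZMod p × ZMod p → ℕ := fun q => (u * (q.1 - q.2 - y₀)).val with hf
  have hq : ∀ k, ∃ q ∈ (C k) ×ˢ (B k), ∀ q' ∈ (C k) ×ˢ (B k), f q ≤ f q' :=
    fun k => Finset.exists_min_image _ f ((hC k).product (hB k))
  choose q hqmem hqmin using hq
  set bs : Fin N → ZMod p := fun k => (q k).2 with hbs
  have hbsmem : ∀ k, bs k ∈ B k := fun k => (Finset.mem_product.1 (hqmem k)).2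
  have hcsmem : ∀ k, (q k).1 ∈ C k := fun k => (Finset.mem_product.1 (hqmem k)).1
  set φB : Fin N → ZMod p → ZMod p := fun k x => u * (x - bs k) with hφB
  set φC : Fin N → ZMod p → ZMod p := fun k x => u * (x - bs k - y₀) with hφC
  set φA : Fin N → ZMod p → ZMod p := fun k x => u * (x - bs k - y₀ + z₀) with hφA
  have hinjB : ∀ k, Function.Injective (φB k) := fun k x x' h => by
    have := mul_left_cancel₀ hu0 h; simpa using this
  have hinjC : ∀ k, Function.Injective (φC k) := fun k x x' h => by
    have := mul_left_cancel₀ hu0 h; simpa using this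
  have hinjA : ∀ k, Function.Injective (φA k) := fun k x x' h => by
    have := mul_left_cancel₀ hu0 h; simpa using this
  have hvinj : Function.Injective (ZMod.val : ZMod p → ℕ) := ZMod.val_injective p
  set Av : Fin N → Finset ℕ := fun k => (A k).image (fun x => (φA k x).val) with hAv
  set Bv : Fin N → Finset ℕ := fun k => (B k).image (fun x => (φB k x).val) with hBv
  set Cv : Fin N → Finset ℕ := fun k => (C k).image (fun x => (φC k x).val) with hCv
  -- differences of normalised values
  have hdiffCB : ∀ k, ∀ c₀ ∈ C k, ∀ b₀ ∈ B k, ((φC k c₀).val + p - (φB k b₀).val) % p = (u * (c₀ - b₀ - y₀)).val := by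
    intro k c₀ _ b₀ _
    rw [← val_sub_eq_mod]
    congr 1
    simp only [hφC, hφB]; ring
  have hdiffCA : ∀ k, ∀ c₀ ∈ C k, ∀ a₀ ∈ A k, ((φC k c₀).val + p - (φA k a₀).val) % p = (u * (c₀ - a₀ - z₀)).val := by
    intro k c₀ _ a₀ _
    rw [← val_sub_eq_mod]
    congr 1
    simp only [hφC, hφA]; ring
  have hdiffAB : ∀ k, ∀ a₀ ∈ A k, ∀ b₀ ∈ B k, ((φA k a₀).val + p - (φB k b₀).val) % p = (u * (a₀ - b₀ - y₀ + z₀)).val := by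
    intro k a₀ _ b₀ _
    rw [← val_sub_eq_mod]
    congr 1
    simp only [hφA, hφB]; ring
  have hdiffBB : ∀ k, ∀ b₀ ∈ B k, ∀ b₁ ∈ B k, ((φB k b₀).val + p - (φB k b₁).val) % p = (u * (b₀ - b₁)).val := by
    intro k b₀ _ b₁ _
    rw [← val_sub_eq_mod]
    congr 1
    simp only [hφB]; ring
  -- elements of the difference sets of other blocks lie in Y° / Z°
  have hYmem : ∀ k, k ≠ i → ∀ c₀ ∈ C k, ∀ b₀ ∈ B k, c₀ - b₀ ∈ DU B C (univ.erase i) := fun k hk c₀ hc₀ b₀ hb₀ =>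
    D_subset_DU (Finset.mem_erase.2 ⟨hk, Finset.mem_univ k⟩) (mem_D.2 ⟨b₀, hb₀, c₀, hc₀, rfl⟩)
  have hZmem : ∀ k, k ≠ i → ∀ c₀ ∈ C k, ∀ a₀ ∈ A k, c₀ - a₀ ∈ DU A C (univ.erase i) := fun k hk c₀ hc₀ a₀ ha₀ =>
    D_subset_DU (Finset.mem_erase.2 ⟨hk, Finset.mem_univ k⟩) (mem_D.2 ⟨a₀, ha₀, c₀, hc₀, rfl⟩)
  have hiA : ∀ k, Function.Injective (fun x => (φA k x).val) := fun k x x' h => hinjA k (hvinj h)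
  have hiB : ∀ k, Function.Injective (fun x => (φB k x).val) := fun k x x' h => hinjB k (hvinj h)
  have hiC : ∀ k, Function.Injective (fun x => (φC k x).val) := fun k x x' h => hinjC k (hvinj h)
  have hksne : ∀ k ∈ ks, k ≠ i := fun k hk => (hksi k).1 hk
  have hcall := coverYW_complete (p := p) (fun k => k ≠ i) (fun k => (#(A k), #(B k), #(C k))) Av Bv Cv YL.dedup ZL.dedup
    (fun k _ => by simp only [hAv]; rw [Finset.card_image_of_injective _ (hiA k)])
    (fun k _ => by simp only [hBv]; rw [Finset.card_image_of_injective _ (hiB k)])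
    (fun k _ => by simp only [hCv]; rw [Finset.card_image_of_injective _ (hiC k)])
    (fun k x hx => by obtain ⟨y, -, rfl⟩ := Finset.mem_image.1 hx; exact ZMod.val_lt _)
    (fun k x hx => by obtain ⟨y, -, rfl⟩ := Finset.mem_image.1 hx; exact ZMod.val_lt _)
    (fun k x hx => by obtain ⟨y, -, rfl⟩ := Finset.mem_image.1 hx; exact ZMod.val_lt _)
    (fun k _ => Finset.mem_image.2 ⟨bs k, hbsmem k, by simp [hφB]⟩)
    (fun k _ => (hC k).image _)
    (fun k _ c hc c' hc' x hx x' hx' heq => by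
      obtain ⟨c₀, hc₀, rfl⟩ := Finset.mem_image.1 hc
      obtain ⟨c₁, hc₁, rfl⟩ := Finset.mem_image.1 hc'
      obtain ⟨b₀, hb₀, rfl⟩ := Finset.mem_image.1 hx
      obtain ⟨b₁, hb₁, rfl⟩ := Finset.mem_image.1 hx'
      rw [hdiffCB k c₀ hc₀ b₀ hb₀, hdiffCB k c₁ hc₁ b₁ hb₁] at heq
      have h1 : c₀ - b₀ = c₁ - b₁ := by
        have := mul_left_cancel₀ hu0 (hvinj heq); linear_combination this
      obtain ⟨e1, e2⟩ := sub_injOn_of_card_D (card_D_BC hS hA k) hb₀ hb₁ hc₀ hc₁ h1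
      exact ⟨by rw [e2], by rw [e1]⟩)
    (fun k _ c hc c' hc' x hx x' hx' heq => by
      obtain ⟨c₀, hc₀, rfl⟩ := Finset.mem_image.1 hc
      obtain ⟨c₁, hc₁, rfl⟩ := Finset.mem_image.1 hc'
      obtain ⟨a₀, ha₀, rfl⟩ := Finset.mem_image.1 hx
      obtain ⟨a₁, ha₁, rfl⟩ := Finset.mem_image.1 hx'
      rw [hdiffCA k c₀ hc₀ a₀ ha₀, hdiffCA k c₁ hc₁ a₁ ha₁] at heq
      have h1 : c₀ - a₀ = c₁ - a₁ := by
        have := mul_left_cancel₀ hu0 (hvinj heq); linear_combination this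
      obtain ⟨e1, e2⟩ := sub_injOn_of_card_D (card_D_AC hS hB k) ha₀ ha₁ hc₀ hc₁ h1
      exact ⟨by rw [e2], by rw [e1]⟩)
    (fun k _ c hc c' hc' x hx x' hx' heq => by
      obtain ⟨a₀, ha₀, rfl⟩ := Finset.mem_image.1 hc
      obtain ⟨a₁, ha₁, rfl⟩ := Finset.mem_image.1 hc'
      obtain ⟨b₀, hb₀, rfl⟩ := Finset.mem_image.1 hx
      obtain ⟨b₁, hb₁, rfl⟩ := Finset.mem_image.1 hx'
      rw [hdiffAB k a₀ ha₀ b₀ hb₀, hdiffAB k a₁ ha₁ b₁ hb₁] at heq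
      have h1 : b₀ - a₀ = b₁ - a₁ := by
        have := mul_left_cancel₀ hu0 (hvinj heq); linear_combination (-1 : ZMod p) * this
      obtain ⟨e1, e2⟩ := sub_injOn_of_card_D (card_D_AB hS hC k) ha₀ ha₁ hb₀ hb₁ h1
      exact ⟨by rw [e1], by rw [e2]⟩)
    (fun k _ => by
      -- the minimum property from the choice of bs k
      refine ⟨(φC k (q k).1).val, Finset.mem_image.2 ⟨(q k).1, hcsmem k, rfl⟩, fun c hc x hx => ?_⟩
      obtain ⟨c₀, hc₀, rfl⟩ := Finset.mem_image.1 hc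
      obtain ⟨b₀, hb₀, rfl⟩ := Finset.mem_image.1 hx
      rw [hdiffCB k c₀ hc₀ b₀ hb₀]
      have h1 : (φC k (q k).1).val = f (q k) := by
        simp only [hφC, hf, hbs]
      rw [h1]
      exact hqmin k (c₀, b₀) (Finset.mem_product.2 ⟨hc₀, hb₀⟩))
    (fun k hk k' hk' c hc a ha a' ha' b hb hne => by
      -- the word with the two A-letters in blocks k, k' (k ≠ k' or different letters)
      obtain ⟨c₀, hc₀, rfl⟩ := Finset.mem_image.1 hc
      obtain ⟨a₀, ha₀, rfl⟩ := Finset.mem_image.1 ha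
      obtain ⟨a₁, ha₁, rfl⟩ := Finset.mem_image.1 ha'
      obtain ⟨b₁, hb₁, rfl⟩ := Finset.mem_image.1 hb
      rw [hdiffCA k c₀ hc₀ a₀ ha₀, hdiffAB k' a₁ ha₁ b₁ hb₁, List.mem_dedup]
      intro hmem
      have hval : ((u * (c₀ - a₀ - z₀)).val + (u * (a₁ - b₁ - y₀ + z₀)).val) % p = (u * ((c₀ - a₀ + a₁ - b₁) - y₀)).val := by
        rw [← ZMod.val_add]; congr 1; ring
      rw [hval] at hmem
      obtain ⟨x, hx, hxv⟩ := hY2 _ hmem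
      have hxw : x = c₀ - a₀ + a₁ - b₁ := by
        have h2 := mul_left_cancel₀ hu0 (hvinj hxv); linear_combination h2
      obtain ⟨j, hj, hxj⟩ := Finset.mem_biUnion.1 hx
      obtain ⟨b', hb', c', hc', hcb⟩ := mem_D.1 hxj
      have e1 : c' - b' = c₀ - a₀ + a₁ - b₁ := hcb.trans hxw
      obtain ⟨hk'j, hjk, hs, -, -⟩ := hS k' j k a₀ ha₀ a₁ ha₁ b₁ hb₁ b' hb' c' hc' c₀ hc₀ (by linear_combination (-1 : ZMod p) * e1)
      have hkk : k' = k := hk'j.trans hjk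
      subst hkk
      rcases hne with hne | hne
      · exact hne rfl
      · exact hne (by rw [hs]))
    (fun k hk c hc a ha b hb b' hb' hne => by
      -- the word with two different B-letters of block k
      obtain ⟨c₀, hc₀, rfl⟩ := Finset.mem_image.1 hc
      obtain ⟨a₀, ha₀, rfl⟩ := Finset.mem_image.1 ha
      obtain ⟨b₀, hb₀, rfl⟩ := Finset.mem_image.1 hb
      obtain ⟨b₁, hb₁, rfl⟩ := Finset.mem_image.1 hb'
      rw [hdiffCA k c₀ hc₀ a₀ ha₀, hdiffBB k b₀ hb₀ b₁ hb₁, List.mem_dedup]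
      intro hmem
      have hval : ((u * (c₀ - a₀ - z₀)).val + (u * (b₀ - b₁)).val) % p = (u * ((c₀ - a₀ + b₀ - b₁) - z₀)).val := by
        rw [← ZMod.val_add]; congr 1; ring
      rw [hval] at hmem
      obtain ⟨x, hx, hxv⟩ := hZ2 _ hmem
      have hxw : x = c₀ - a₀ + b₀ - b₁ := by
        have h2 := mul_left_cancel₀ hu0 (hvinj hxv); linear_combination h2
      obtain ⟨j, hj, hxj⟩ := Finset.mem_biUnion.1 hx
      obtain ⟨a', ha'', c', hc', hca⟩ := mem_D.1 hxj
      have e1 : c' - a' = c₀ - a₀ + b₀ - b₁ := hca.trans hxw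
      obtain ⟨-, -, -, htt, -⟩ := hS k k j a' ha'' a₀ ha₀ b₀ hb₀ b₁ hb₁ c₀ hc₀ c' hc' (by linear_combination e1)
      exact hne (by rw [htt]))
    ZL.dedup ks hks hksne [] YL.dedup (List.nodup_dedup _) (by simp) (by simp) (by simp)
    (fun k hk c hc x hx => by
      obtain ⟨c₀, hc₀, rfl⟩ := Finset.mem_image.1 hc
      obtain ⟨b₀, hb₀, rfl⟩ := Finset.mem_image.1 hx
      rw [hdiffCB k c₀ hc₀ b₀ hb₀, List.mem_dedup]
      exact hY1 _ (hYmem k (hksne k hk) c₀ hc₀ b₀ hb₀))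
    (fun k hk k' hk' hne c hc x hx c' hc' x' hx' heq => by
      obtain ⟨c₀, hc₀, rfl⟩ := Finset.mem_image.1 hc
      obtain ⟨b₀, hb₀, rfl⟩ := Finset.mem_image.1 hx
      obtain ⟨c₁, hc₁, rfl⟩ := Finset.mem_image.1 hc'
      obtain ⟨b₁, hb₁, rfl⟩ := Finset.mem_image.1 hx'
      rw [hdiffCB k c₀ hc₀ b₀ hb₀, hdiffCB k' c₁ hc₁ b₁ hb₁] at heq
      have h1 : c₀ - b₀ = c₁ - b₁ := by
        have := mul_left_cancel₀ hu0 (hvinj heq); linear_combination this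
      have hm0 : c₀ - b₀ ∈ D B C k := mem_D.2 ⟨b₀, hb₀, c₀, hc₀, rfl⟩
      have hm1 : c₁ - b₁ ∈ D B C k' := mem_D.2 ⟨b₁, hb₁, c₁, hc₁, rfl⟩
      rw [h1] at hm0
      exact Finset.disjoint_left.1 (disjoint_D_BC hS hA hne) hm0 hm1)
    (fun y hyin => by
      obtain ⟨x, hx, hxy⟩ := hY2 y (List.mem_dedup.1 hyin)
      obtain ⟨k, hk, hyk⟩ := Finset.mem_biUnion.1 hx
      obtain ⟨b₀, hb₀, c₀, hc₀, hcb⟩ := mem_D.1 hyk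
      refine ⟨k, (hksi k).2 (Finset.mem_erase.1 hk).1, (φC k c₀).val, Finset.mem_image.2 ⟨c₀, hc₀, rfl⟩,
        (φB k b₀).val, Finset.mem_image.2 ⟨b₀, hb₀, rfl⟩, ?_⟩
      rw [hdiffCB k c₀ hc₀ b₀ hb₀, hcb, hxy])
    (fun k hk c hc x hx => by
      have hk' : k ≠ i := by
        rcases hk with hk | hk
        · exact hksne k hk
        · simp at hk
      obtain ⟨c₀, hc₀, rfl⟩ := Finset.mem_image.1 hc
      obtain ⟨a₀, ha₀, rfl⟩ := Finset.mem_image.1 hx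
      rw [hdiffCA k c₀ hc₀ a₀ ha₀, List.mem_dedup]
      exact hZ1 _ (hZmem k hk' c₀ hc₀ a₀ ha₀))
    (fun k k' _ _ hne c hc x hx c' hc' x' hx' heq => by
      obtain ⟨c₀, hc₀, rfl⟩ := Finset.mem_image.1 hc
      obtain ⟨a₀, ha₀, rfl⟩ := Finset.mem_image.1 hx
      obtain ⟨c₁, hc₁, rfl⟩ := Finset.mem_image.1 hc'
      obtain ⟨a₁, ha₁, rfl⟩ := Finset.mem_image.1 hx'
      rw [hdiffCA k c₀ hc₀ a₀ ha₀, hdiffCA k' c₁ hc₁ a₁ ha₁] at heq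
      have h1 : c₀ - a₀ = c₁ - a₁ := by
        have := mul_left_cancel₀ hu0 (hvinj heq); linear_combination this
      have hm0 : c₀ - a₀ ∈ D A C k := mem_D.2 ⟨a₀, ha₀, c₀, hc₀, rfl⟩
      have hm1 : c₁ - a₁ ∈ D A C k' := mem_D.2 ⟨a₁, ha₁, c₁, hc₁, rfl⟩
      rw [h1] at hm0
      exact Finset.disjoint_left.1 (disjoint_D_AC hS hB hne) hm0 hm1)
    (fun t htin => by
      obtain ⟨x, hx, hxt⟩ := hZ2 t (List.mem_dedup.1 htin)
      obtain ⟨k, hk, hzk⟩ := Finset.mem_biUnion.1 hx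
      obtain ⟨a₀, ha₀, c₀, hc₀, hca⟩ := mem_D.1 hzk
      refine ⟨k, Or.inl ((hksi k).2 (Finset.mem_erase.1 hk).1), (φC k c₀).val, Finset.mem_image.2 ⟨c₀, hc₀, rfl⟩,
        (φA k a₀).val, Finset.mem_image.2 ⟨a₀, ha₀, rfl⟩, ?_⟩
      rw [hdiffCA k c₀ hc₀ a₀ ha₀, hca, hxt])
  simpa using hcall

end Extract

end Summit.MatrixMultiplication.OmegaCensus.CubeNB
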